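import Mathlib.Dynamics.OmegaLimit
import Literature.Geometry.Lorentzian.BoundedGeometry
import Literature.Geometry.Lorentzian.BurnettConvergence
import Literature.Geometry.Lorentzian.BurnettDefectMeasure
import HarnessLib

/-!
# Late-time ω-limit sets of a spacetime seen through a late chart, in the Burnett topology

Route-posited object `LateTimeOmegaLimitSet` (route BurnettKineticRigidity of the final state
conjecture, item LateTimeBurnettCompactness). Given a spacetime `𝓢` (e.g. the carrier of a
`VacuumCauchyDevelopment`), a reference background `B` (`ModelBackground`, `KerrConvergence.lean`)
and a chart map `Ψ : B.domain → 𝓢.carrier` (a late chart, `Spacetime.IsLateChart`), we define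

* `ModelBackground.timeSlabIoo B τ₀ L` — the open coordinate slab `S_L = {τ₀ < t < τ₀ + L}`;
* `ModelBackground.IsStationary B` — invariance of `(U, g₀, t, r)` under the time translations
  `x ↦ x + T ∂₀` of `E4` (`t ↦ t + T`), the shift maps `IsStationary.shift T : U → U`, and the
  instances `Minkowski.isStationary_background`, `Kerr.isStationary_background`;
* `Spacetime.translatedChartMetric 𝓢 B Ψ T = (Ψ^* g)(· + T ∂₀)` — the **translates** of the
  pulled-back components `Ψ^* g` (`Spacetime.chartMetricExtend` of `BoundedGeometry.lean`, the
  extension by zero off `U`); for a stationary background these are the components of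
  `(Ψ ∘ shift_T)^* g`, since `d(shift_T) = id`;
* `seqOmegaLimit lim u` — the ω-limit set of a curve `u : ℝ → X` for a *sequential convergence
  relation* `lim : (ℕ → X) → Λ → Prop` (Hale 1980, Ch. I, §8: "`q ∈ ω(γ)` iff `φ(t_k, p) → q`
  along some `t_k → ∞`"); for the convergence of a first-countable topology it is the set of
  cluster points, i.e. Mathlib's `omegaLimit` (`seqOmegaLimit_eq_omegaLimit`);
* `Spacetime.lateTimeOmegaLimitSet 𝓢 B lim Ψ τ₀ L` — the late-time ω-limit set of the curve
  `T ↦ g_T` for a convergence notion `lim S_L` on the slab (a PARAMETER: Lott 2018, §2.1, "the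
  notion of convergence of metrics depends on the topology that we want to consider"; limit data
  `Λ` may be pairs `(g_∞, μ_∞)` once defect measures are attached), and its principal instance
  `Spacetime.lateTimeBurnettOmegaLimitSet 𝓢 B Ψ τ₀ L` for `BurnettConverges S_L`
  (`BurnettConvergence.lean`: locally uniform convergence with equi-Lipschitz bounds, Burnett 1989
  / Huneau–Luk 2024, Remark 1.3), whose members are locally Lipschitz, and
  `Spacetime.lateTimeBurnettDefectOmegaLimitSet` — the pairs `(g_∞, μ_∞)` with `μ_∞` a
  defect-measure datum of the same translates (`IsBurnettDefectDatum`,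
  `BurnettDefectMeasure.lean`; Huneau–Luk 2024, Def. 4.1);
* `Spacetime.HasUniformBurnettBounds 𝓢 B Ψ τ₀ L` — the a-priori bound predicate: the `C⁰` and
  `C¹` sup norms of `g_T` over `S_L` are bounded uniformly in `T ≥ 0` (Huneau–Luk 2024,
  Assumptions 1.2 (2)–(3) without frequency scale: `sup_n |∂g_n| < ∞`, Remark 1.3); for a
  stationary background equivalently finiteness of the `C¹` size `chartMetricCk` of `Ψ^* g` on
  the late region `{t > τ₀}` (`hasUniformBurnettBounds_iff_of_isStationary`).

Interface only: nothing here asserts that ω-limit sets are nonempty, compact or invariant (the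
content of the route item), nor that defect measures exist (Gérard's theorem). Not here: the
wave-coordinate defect control (`WaveCoordinateCondition`), and the identity
`(Ψ ∘ shift_T)^* g = (Ψ^* g) ∘ shift_T` as a lemma about `pullbackBilin` (it only motivates
`translatedChartMetric`). The Kerr–Schild
stationarity lemmas are reproved privately (they exist in `KerrSchildCoord.lean`, whose import
cone — wave decay, energy currents — an interface file should not inherit).

## References

* J. K. Hale, *Ordinary Differential Equations*, 2nd ed., Krieger 1980, Ch. I, §8 (Thm. 8.1).
* J. Lott, *Backreaction in the future behavior of an expanding vacuum spacetime*, CQG 35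
  (2018) 035010 = arXiv:1709.03952, §2.1–2.3 (limits `φ_i^* g_i → g_∞` along comparison maps).
* C. Huneau, J. Luk, arXiv:2403.03470, Assumptions 1.2, Remark 1.3; arXiv:1907.10743, §1.
* G. A. Burnett, J. Math. Phys. 30 (1989) 90; DHRT arXiv:2104.08222, §1 (late-time charts);
  Dafermos–Rodnianski arXiv:0811.0354, §5.1 (`t*`-translations of Kerr–Schild coordinates).
-/

noncomputable section

open TopologicalSpace Filter Set Manifold
open scoped ENNReal NNReal ContDiff Topology

universe u

namespace Literature.Geometry.Lorentzian

/-! ### Sequential ω-limit sets of a curve (Hale) -/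

section SeqOmegaLimit

variable {X Λ : Type*}

/-- The **ω-limit set of the curve `u : ℝ → X` with respect to the sequential convergence
relation `lim`** (`lim s l`: "the sequence `s` converges to the limit datum `l`"): the set of
`l : Λ` such that `lim (u ∘ T) l` for some sequence of times `T n → +∞`. For `lim` the
convergence of a topology this is Hale's definition of `ω(γ)` ("`q ∈ ω(γ)` if there is a
sequence `t_k → ∞` with `φ(t_k, p) → q`"), Hale 1980, Ch. I, §8, and agrees with Mathlib's
`omegaLimit` in first-countable spaces (`seqOmegaLimit_eq_omegaLimit`); a relation-valued `lim`
accommodates convergences carrying uniform bounds and extra limit data (weak-* limits with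
defect measures). [cite: Hale1980, Ch. I §8] -/
def seqOmegaLimit (lim : (ℕ → X) → Λ → Prop) (u : ℝ → X) : Set Λ :=
  {l | ∃ T : ℕ → ℝ, Tendsto T atTop atTop ∧ lim (u ∘ T) l}

variable {lim lim' : (ℕ → X) → Λ → Prop} {u : ℝ → X}

/-- Membership in the sequential ω-limit set (Hale 1980, Ch. I, §8). [cite: Hale1980, Ch. I §8] -/
theorem mem_seqOmegaLimit_iff {l : Λ} :
    l ∈ seqOmegaLimit lim u ↔ ∃ T : ℕ → ℝ, Tendsto T atTop atTop ∧ lim (u ∘ T) l :=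
  Iff.rfl

/-- A weaker convergence relation has a larger ω-limit set (Hale 1980, Ch. I, §8). [cite: Hale1980, Ch. I §8] -/
theorem seqOmegaLimit_mono (h : ∀ s l, lim s l → lim' s l) :
    seqOmegaLimit lim u ⊆ seqOmegaLimit lim' u :=
  fun _ ⟨T, hT, hl⟩ ↦ ⟨T, hT, h _ _ hl⟩

/-- The ω-limit set only depends on the tail of the curve: translating time does not change it
(the first step of Hale 1980, Ch. I, §8, Thm. 8.1). [cite: Hale1980, Ch. I §8 Thm. 8.1] -/
theorem seqOmegaLimit_comp_add_right (lim : (ℕ → X) → Λ → Prop) (u : ℝ → X) (s : ℝ) :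
    seqOmegaLimit lim (fun t ↦ u (t + s)) = seqOmegaLimit lim u := by
  ext l
  constructor
  · rintro ⟨T, hT, hl⟩
    exact ⟨fun n ↦ T n + s, tendsto_atTop_add_const_right _ _ hT, hl⟩
  · rintro ⟨T, hT, hl⟩
    refine ⟨fun n ↦ T n + -s, tendsto_atTop_add_const_right _ _ hT, ?_⟩
    have : ((fun t ↦ u (t + s)) ∘ fun n ↦ T n + -s) = u ∘ T := by
      funext n
      simp
    rwa [this]

variable [TopologicalSpace X]

/-- For the convergence of a topology, every sequential ω-limit point is a cluster point of the
curve at `+∞` (Hale 1980, Ch. I, §8, the inclusion `ω(γ) ⊆ ⋂_τ cl ⋃_{t ≥ τ} φ(t, p)`). [cite: Hale1980, Ch. I §8] -/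
theorem mapClusterPt_of_mem_seqOmegaLimit {u : ℝ → X} {l : X}
    (h : l ∈ seqOmegaLimit (fun s l ↦ Tendsto s atTop (𝓝 l)) u) : MapClusterPt l atTop u := by
  obtain ⟨T, hT, hl⟩ := h
  exact MapClusterPt.of_comp hT hl.mapClusterPt

/-- In a first-countable space every cluster point of the curve at `+∞` is a sequential ω-limit
point (Hale 1980, Ch. I, §8, "it is easy to prove that equivalent definitions are …"). [cite: Hale1980, Ch. I §8] -/
theorem mem_seqOmegaLimit_of_mapClusterPt [FirstCountableTopology X] {u : ℝ → X} {l : X}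
    (h : MapClusterPt l atTop u) : l ∈ seqOmegaLimit (fun s l ↦ Tendsto s atTop (𝓝 l)) u := by
  haveI : (atTop ⊓ comap u (𝓝 l) : Filter ℝ).NeBot := by
    refine Filter.NeBot.of_map (m := u) ?_
    rw [Filter.push_pull, inf_comm]
    exact h.clusterPt.neBot
  obtain ⟨T, hT⟩ := Filter.exists_seq_tendsto (atTop ⊓ comap u (𝓝 l) : Filter ℝ)
  rw [Filter.tendsto_inf] at hT
  exact ⟨T, hT.1, Filter.tendsto_comap_iff.1 hT.2⟩

/-- In a first-countable space the sequential ω-limit set of a curve is its set of cluster points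
at `+∞` (Hale 1980, Ch. I, §8). [cite: Hale1980, Ch. I §8] -/
theorem seqOmegaLimit_eq_setOf_mapClusterPt [FirstCountableTopology X] (u : ℝ → X) :
    seqOmegaLimit (fun s l ↦ Tendsto s atTop (𝓝 l)) u = {l | MapClusterPt l atTop u} :=
  Set.ext fun _ ↦ ⟨mapClusterPt_of_mem_seqOmegaLimit, mem_seqOmegaLimit_of_mapClusterPt⟩

/-- In a first-countable space the sequential ω-limit set is Mathlib's ω-limit set
`ω atTop (fun t _ ↦ u t) {a} = ⋂_τ closure (u '' [τ, ∞))` of the one-orbit flow (Hale 1980,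
Ch. I, §8, `ω(γ) = ⋂_τ cl ⋃_{t ≥ τ} φ(t, p)`). [cite: Hale1980, Ch. I §8] -/
theorem seqOmegaLimit_eq_omegaLimit [FirstCountableTopology X] (u : ℝ → X) {α : Type*}
    (a : α) :
    seqOmegaLimit (fun s l ↦ Tendsto s atTop (𝓝 l)) u =
      omegaLimit atTop (fun t (_ : α) ↦ u t) {a} := by
  ext l
  rw [seqOmegaLimit_eq_setOf_mapClusterPt, mem_setOf_eq, mem_omegaLimit_singleton_iff_mapClusterPt]

end SeqOmegaLimit

/-! ### Slabs, stationary backgrounds and time shifts -/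

namespace ModelBackground

/-- The **open time slab** `S = {x ∈ U | τ₀ < t(x) < τ₀ + L}` of length `L` after `τ₀` of a
reference background (the bounded-in-time domains `U` of Huneau–Luk, arXiv:2403.03470,
Assumptions 1.2, cut out by the time function of DHRT arXiv:2104.08222, §1). [cite: HuneauLuk2024wave, Assumptions 1.2] -/
def timeSlabIoo (B : ModelBackground) (τ₀ L : ℝ) : Set B.domain :=
  {x | τ₀ < B.time x.1 ∧ B.time x.1 < τ₀ + L}

/-- Membership in the open time slab. [cite: HuneauLuk2024wave, Assumptions 1.2] -/
@[simp]
theorem mem_timeSlabIoo {B : ModelBackground} {τ₀ L : ℝ} {x : B.domain} :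
    x ∈ B.timeSlabIoo τ₀ L ↔ τ₀ < B.time x.1 ∧ B.time x.1 < τ₀ + L :=
  Iff.rfl

/-- The open slab after `τ₀` lies in the late region `{t > τ₀}` (DHRT arXiv:2104.08222, §1). [cite: arXiv210408222, §1] -/
theorem timeSlabIoo_subset_lateRegion (B : ModelBackground) (τ₀ L : ℝ) :
    B.timeSlabIoo τ₀ L ⊆ B.lateRegion τ₀ := fun _ hx ↦ hx.1

/-- Slabs starting later than `τ₀` lie in the late region `{t > τ₀}` (DHRT arXiv:2104.08222, §1). [cite: arXiv210408222, §1] -/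
theorem timeSlabIoo_subset_lateRegion_of_le (B : ModelBackground) {τ₀ τ₁ : ℝ} (h : τ₀ ≤ τ₁)
    (L : ℝ) : B.timeSlabIoo τ₁ L ⊆ B.lateRegion τ₀ := fun _ hx ↦ h.trans_lt hx.1

/-- Open slabs grow with their length. [cite: HuneauLuk2024wave, Assumptions 1.2] -/
theorem timeSlabIoo_mono (B : ModelBackground) (τ₀ : ℝ) {L L' : ℝ} (h : L ≤ L') :
    B.timeSlabIoo τ₀ L ⊆ B.timeSlabIoo τ₀ L' := fun _ hx ↦ ⟨hx.1, hx.2.trans_le (by linarith)⟩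

/-- The level sets `{t = τ}`, `τ₀ < τ < τ₀ + L`, lie in the open slab (DHRT arXiv:2104.08222, §1). [cite: arXiv210408222, §1] -/
theorem timeSlab_subset_timeSlabIoo (B : ModelBackground) {τ₀ L τ : ℝ} (h₁ : τ₀ < τ)
    (h₂ : τ < τ₀ + L) : B.timeSlab τ ⊆ B.timeSlabIoo τ₀ L := fun x hx ↦ by
  rw [mem_timeSlab] at hx
  exact ⟨hx ▸ h₁, hx ▸ h₂⟩

/-- The reference background `B = (U, g₀, t, r)` is **stationary in the chart time**: the time
translations `x ↦ x + T ∂₀` of `E4` preserve the domain `U`, the reference components `g₀` and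
the radius function, and shift the time function by `T`. This is what makes the time-shift maps
`shift_T : U → U` of late-time limits available (Kerr–Schild `t*`-translations:
Dafermos–Rodnianski arXiv:0811.0354, §5.1; Kerr–Schild 1965, §2 — `Kerr.isStationary_background`;
Minkowski — `Minkowski.isStationary_background`). [cite: KerrSchild1965, §2] -/
structure IsStationary (B : ModelBackground) : Prop where
  /-- `U + T ∂₀ = U`. -/
  add_mem_iff : ∀ (T : ℝ) (x : E4), x + T • E4.basisVector 0 ∈ B.domain ↔ x ∈ B.domain
  /-- The reference components do not depend on `t`. -/
  bilin_add : ∀ (T : ℝ) (x : E4), B.bilin (x + T • E4.basisVector 0) = B.bilin x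
  /-- The time function is shifted: `t(x + T ∂₀) = t(x) + T`. -/
  time_add : ∀ (T : ℝ) (x : E4), B.time (x + T • E4.basisVector 0) = B.time x + T
  /-- The radius function does not depend on `t`. -/
  radius_add : ∀ (T : ℝ) (x : E4), B.radius (x + T • E4.basisVector 0) = B.radius x

namespace IsStationary

variable {B : ModelBackground}

/-- The **time-shift map** `shift_T : U → U`, `x ↦ x + T ∂₀`, of a stationary background (the
`t*`-translations `φ_T` of Dafermos–Rodnianski arXiv:0811.0354, §5.1). [cite: arXiv08110354, §5.1] -/
def shift (hB : B.IsStationary) (T : ℝ) (x : B.domain) : B.domain :=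
  ⟨x.1 + T • E4.basisVector 0, (hB.add_mem_iff T x.1).2 x.2⟩

/-- Coordinates of the shifted point: `shift_T x = x + T ∂₀`. [cite: arXiv08110354, §5.1] -/
@[simp]
theorem coe_shift (hB : B.IsStationary) (T : ℝ) (x : B.domain) :
    (hB.shift T x : E4) = x.1 + T • E4.basisVector 0 :=
  rfl

/-- `shift_0 = id`. [folklore] -/
@[simp]
theorem shift_zero (hB : B.IsStationary) (x : B.domain) : hB.shift 0 x = x := by
  ext1
  simp

/-- The flow law `shift_{S + T} = shift_T ∘ shift_S`. [folklore] -/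
theorem shift_add (hB : B.IsStationary) (S T : ℝ) (x : B.domain) :
    hB.shift (S + T) x = hB.shift T (hB.shift S x) := by
  ext1
  simp [add_smul, add_assoc]

/-- The time function along the shift: `t(shift_T x) = t(x) + T`. [cite: arXiv08110354, §5.1] -/
theorem time_shift (hB : B.IsStationary) (T : ℝ) (x : B.domain) :
    B.time (hB.shift T x).1 = B.time x.1 + T :=
  hB.time_add T x.1

/-- `shift_T` maps the slab `{τ₀ < t < τ₀ + L}` onto the slab `{τ₀ + T < t < τ₀ + T + L}`. [cite: arXiv08110354, §5.1] -/
theorem image_shift_timeSlabIoo (hB : B.IsStationary) (T τ₀ L : ℝ) :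
    hB.shift T '' B.timeSlabIoo τ₀ L = B.timeSlabIoo (τ₀ + T) L := by
  ext x
  simp only [mem_image, mem_timeSlabIoo]
  constructor
  · rintro ⟨y, ⟨hy₁, hy₂⟩, rfl⟩
    rw [time_shift]
    exact ⟨by linarith, by linarith⟩
  · rintro ⟨hx₁, hx₂⟩
    refine ⟨hB.shift (-T) x, ?_, ?_⟩
    · rw [time_shift]
      exact ⟨by linarith, by linarith⟩
    · rw [← shift_add, neg_add_cancel, shift_zero]

/-- In coordinates: translating the slab `{τ₀ < t < τ₀ + L}` by `T ∂₀` gives the slab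
`{τ₀ + T < t < τ₀ + T + L}`. [cite: arXiv08110354, §5.1] -/
theorem image_add_timeSlabIoo (hB : B.IsStationary) (T τ₀ L : ℝ) :
    (fun x : E4 ↦ x + T • E4.basisVector 0) '' (Subtype.val '' B.timeSlabIoo τ₀ L) =
      Subtype.val '' B.timeSlabIoo (τ₀ + T) L := by
  rw [← hB.image_shift_timeSlabIoo T τ₀ L, image_image, image_image]
  rfl

end IsStationary

/-- For `0 < L`, the late region `{t > τ₀}` is the union of the slabs `{τ₀ + T < t < τ₀ + T + L}`,
`T ≥ 0`. [folklore] -/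
theorem iUnion_timeSlabIoo_eq_lateRegion (B : ModelBackground) {L : ℝ} (hL : 0 < L) (τ₀ : ℝ) :
    ⋃ (T : ℝ) (_ : 0 ≤ T), B.timeSlabIoo (τ₀ + T) L = B.lateRegion τ₀ := by
  refine Subset.antisymm (iUnion₂_subset fun T hT ↦
    B.timeSlabIoo_subset_lateRegion_of_le (by linarith) L) fun x hx ↦ ?_
  rw [mem_lateRegion] at hx
  refine mem_iUnion₂.2 ⟨max 0 (B.time x.1 - τ₀ - L / 2), le_max_left _ _, ?_, ?_⟩
  · rcases le_total 0 (B.time x.1 - τ₀ - L / 2) with h | h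
    · rw [max_eq_right h]; linarith
    · rw [max_eq_left h]; linarith
  · rcases le_total 0 (B.time x.1 - τ₀ - L / 2) with h | h
    · rw [max_eq_right h]; linarith
    · rw [max_eq_left h]; linarith

end ModelBackground

/-- The spatial projection is invariant under time translations: `(x + T ∂₀)̲ = x̲`. [folklore] -/
private theorem E4.spatial_add_time_smul (x : E4) (T : ℝ) :
    E4.spatial (x + T • E4.basisVector 0) = E4.spatial x := by
  ext i
  simp [E4.spatial_apply, Fin.succ_ne_zero]

/-- The Kerr–Schild radius does not depend on `t*` (Visser arXiv:0706.0622, (35); this is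
`Kerr.radius_add_time_smul_basisVector` of `KerrSchildCoord.lean`, reproved to spare the import).
[cite: arXiv07060622, (35)] -/
private theorem Kerr.radius_add_time_smul (a : ℝ) (x : E4) (T : ℝ) :
    Kerr.radius a (x + T • E4.basisVector 0) = Kerr.radius a x := by
  have h3 : (x + T • E4.basisVector 0) 3 = x 3 := by simp
  have hs : E4.spatialNorm (x + T • E4.basisVector 0) = E4.spatialNorm x := by
    simp only [E4.spatialNorm, E4.spatial_add_time_smul]
  simp only [Kerr.radius, hs, h3]

/-- Stationarity of the Kerr–Schild components, `g_{x + T ∂₀} = g_x` (Kerr–Schild 1965, §2; this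
is `Kerr.bilin_add_smul_basisVector_zero` of `KerrSchildCoord.lean`, reproved to spare the
import). [cite: KerrSchild1965, §2] -/
private theorem Kerr.bilin_add_time_smul (M a : ℝ) (x : E4) (T : ℝ) :
    Kerr.bilin M a (x + T • E4.basisVector 0) = Kerr.bilin M a x := by
  have h1 : (x + T • E4.basisVector 0) 1 = x 1 := by simp
  have h2 : (x + T • E4.basisVector 0) 2 = x 2 := by simp
  have h3 : (x + T • E4.basisVector 0) 3 = x 3 := by simp
  simp only [Kerr.bilin, Kerr.scalarH, Kerr.nullCovector, Kerr.nullCovectorFun,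
    Kerr.radius_add_time_smul, h1, h2, h3]

/-- The Minkowski background `(E4, η, x⁰, |x̲|)` is stationary. [folklore] -/
theorem Minkowski.isStationary_background : Minkowski.background.IsStationary where
  add_mem_iff _ _ := by simp [Minkowski.background, Minkowski.backgroundOn]
  bilin_add _ _ := rfl
  time_add T x := by simp [Minkowski.background, Minkowski.backgroundOn]
  radius_add T x := by
    simp only [Minkowski.background, Minkowski.backgroundOn, E4.spatialNorm,
      E4.spatial_add_time_smul]

/-- The Kerr background `(Kerr.exterior M a, g_{M,a}, t*, r)` in ingoing Kerr–Schild coordinates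
is stationary: `r`, `H`, `ℓ` and hence `g_{M,a} = η + 2H ℓ ⊗ ℓ` do not depend on `t*`, whose
translations are the flow of the Killing field `∂_{t*}` (Kerr–Schild 1965, §2;
Dafermos–Rodnianski arXiv:0811.0354, §5.1). [cite: KerrSchild1965, §2] -/
theorem Kerr.isStationary_background (M a : ℝ) : (Kerr.background M a).IsStationary where
  add_mem_iff T x := by
    simp only [Kerr.background, Kerr.mem_exterior, Kerr.radius_add_time_smul]
  bilin_add T x := Kerr.bilin_add_time_smul M a x T
  time_add T x := by simp [Kerr.background]
  radius_add T x := Kerr.radius_add_time_smul a x T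

/-! ### Chart metrics, their translates, the late-time ω-limit set, uniform bounds -/

namespace Spacetime

variable (𝓢 : Spacetime.{u} 4) (B : ModelBackground)

/-- The **translated chart metric** `g_T := (Ψ^* g)(· + T ∂₀)`: the chart metric components
(`chartMetricExtend`, `BoundedGeometry.lean`: `Ψ^* g` extended by zero off `U`, so that Mathlib's
`iteratedFDeriv` applies) read off after translating the chart time by `T`. For a stationary
background these are the components of `(Ψ ∘ shift_T)^* g` on `U` (chain rule, `d(shift_T) = id`,
`translatedChartMetric_coe`), i.e. the comparison maps of Lott 2018, §2.1 (`φ_i^* g` with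
`φ_i = Ψ ∘ shift_{T_i}`, no rescaling) specialised to the late-time translates of one development. [cite: Lott2018, §2.1] -/
def translatedChartMetric (Ψ : B.domain → 𝓢.carrier) (T : ℝ) (x : E4) :
    E4 →L[ℝ] E4 →L[ℝ] ℝ :=
  𝓢.chartMetricExtend B Ψ (x + T • E4.basisVector 0)

/-- `g_0 = Ψ^* g`. [cite: Lott2018, §2.1] -/
@[simp]
theorem translatedChartMetric_zero (Ψ : B.domain → 𝓢.carrier) :
    𝓢.translatedChartMetric B Ψ 0 = 𝓢.chartMetricExtend B Ψ := by
  funext x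
  simp [translatedChartMetric]

/-- The flow law of the translates: `g_{S + T} = g_S (· + T ∂₀)`. [cite: Lott2018, §2.1] -/
theorem translatedChartMetric_add (Ψ : B.domain → 𝓢.carrier) (S T : ℝ) :
    𝓢.translatedChartMetric B Ψ (S + T) =
      fun x ↦ 𝓢.translatedChartMetric B Ψ S (x + T • E4.basisVector 0) := by
  funext x
  simp only [translatedChartMetric, add_smul, add_assoc, add_comm (T • E4.basisVector 0)]

/-- Derivatives of the translates are the translated derivatives:
`Dⁿ g_T (x) = Dⁿ(Ψ^* g)(x + T ∂₀)` (Mathlib `iteratedFDeriv_comp_add_right`). [folklore] -/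
theorem iteratedFDeriv_translatedChartMetric (Ψ : B.domain → 𝓢.carrier) (n : ℕ) (T : ℝ)
    (x : E4) : iteratedFDeriv ℝ n (𝓢.translatedChartMetric B Ψ T) x =
      iteratedFDeriv ℝ n (𝓢.chartMetricExtend B Ψ) (x + T • E4.basisVector 0) :=
  iteratedFDeriv_comp_add_right n _ x

/-- The `Cᵏ` sup norm of `g_T` over `S` is the `Cᵏ` sup norm of `Ψ^* g` over `S + T ∂₀`. [folklore] -/
theorem supCkENorm_translatedChartMetric (Ψ : B.domain → 𝓢.carrier) (S : Set E4) (k : ℕ)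
    (T : ℝ) : supCkENorm S k (𝓢.translatedChartMetric B Ψ T) =
      supCkENorm ((fun x : E4 ↦ x + T • E4.basisVector 0) '' S) k (𝓢.chartMetricExtend B Ψ) := by
  simp only [supCkENorm, iteratedFDeriv_translatedChartMetric, iSup_image]

variable {B} in
/-- On the domain of a stationary background, `g_T(x) = (Ψ^* g)(shift_T x)` (`chartMetric` of
`BoundedGeometry.lean`). [cite: Lott2018, §2.1] -/
theorem translatedChartMetric_coe (hB : B.IsStationary) (Ψ : B.domain → 𝓢.carrier) (T : ℝ)
    (x : B.domain) : 𝓢.translatedChartMetric B Ψ T x = 𝓢.chartMetric B Ψ (hB.shift T x) :=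
  𝓢.chartMetricExtend_coe B Ψ (hB.shift T x)

variable {B} in
/-- For a stationary background, the `Cᵏ` sup norm of `g_T` over the slab `{τ₀ < t < τ₀ + L}` is
the `Cᵏ` size `chartMetricCk` of `Ψ^* g` over the slab `{τ₀ + T < t < τ₀ + T + L}`. [cite: arXiv08110354, §5.1] -/
theorem supCkENorm_translatedChartMetric_timeSlabIoo (hB : B.IsStationary)
    (Ψ : B.domain → 𝓢.carrier) (k : ℕ) (T τ₀ L : ℝ) :
    supCkENorm (Subtype.val '' B.timeSlabIoo τ₀ L) k (𝓢.translatedChartMetric B Ψ T) =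
      𝓢.chartMetricCk B Ψ k (B.timeSlabIoo (τ₀ + T) L) := by
  rw [supCkENorm_translatedChartMetric, hB.image_add_timeSlabIoo]
  rfl

/-- The **late-time ω-limit set** of the spacetime `𝓢` seen through the chart `Ψ` on the
background `B`, on the slab `S_L = {τ₀ < t < τ₀ + L}`, with respect to the convergence notion
`lim` (`lim S s l`: "the sequence `s` of component maps converges on the set `S ⊆ E4` to the
limit datum `l`"): the set of all `l : Λ` — a chart metric `g_∞` on `S_L`, or a pair
`(g_∞, μ_∞)` with a defect measure, according to `Λ` — such that `g_{T_n} → l` in the sense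
`lim S_L` along some sequence `T_n → +∞` (`seqOmegaLimit` of the curve `T ↦ g_T`). This is the
ω-limit set of Hale 1980, Ch. I, §8 for the late-time translates (Lott 2018, §2.1–2.3: limits
`φ_i^* g → g_∞` of a single spacetime along comparison maps, "the notion of convergence depends
on the topology that we want to consider"); the principal instance is `lim = BurnettConverges`
(`lateTimeBurnettOmegaLimitSet`: locally uniform convergence with equi-Lipschitz bounds, hence
weakly-* converging first derivatives; Huneau–Luk arXiv:2403.03470, Remark 1.3). No existence is
claimed. [cite: Lott2018, §2.1] -/
def lateTimeOmegaLimitSet {Λ : Type*}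
    (lim : Set E4 → (ℕ → E4 → E4 →L[ℝ] E4 →L[ℝ] ℝ) → Λ → Prop)
    (Ψ : B.domain → 𝓢.carrier) (τ₀ L : ℝ) : Set Λ :=
  seqOmegaLimit (lim (Subtype.val '' B.timeSlabIoo τ₀ L)) (𝓢.translatedChartMetric B Ψ)

section

variable {Λ : Type*} {lim lim' : Set E4 → (ℕ → E4 → E4 →L[ℝ] E4 →L[ℝ] ℝ) → Λ → Prop}
  {Ψ : B.domain → 𝓢.carrier} {τ₀ L : ℝ}

/-- Membership in the late-time ω-limit set: `g_{T_n} → l` on `S_L` along some `T_n → ∞`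
(Hale 1980, Ch. I, §8). [cite: Hale1980, Ch. I §8] -/
theorem mem_lateTimeOmegaLimitSet_iff {l : Λ} :
    l ∈ 𝓢.lateTimeOmegaLimitSet B lim Ψ τ₀ L ↔ ∃ T : ℕ → ℝ, Tendsto T atTop atTop ∧
      lim (Subtype.val '' B.timeSlabIoo τ₀ L) (fun n ↦ 𝓢.translatedChartMetric B Ψ (T n)) l :=
  Iff.rfl

/-- A weaker convergence notion has a larger late-time ω-limit set. [cite: Hale1980, Ch. I §8] -/
theorem lateTimeOmegaLimitSet_mono (h : ∀ S s l, lim S s l → lim' S s l) :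
    𝓢.lateTimeOmegaLimitSet B lim Ψ τ₀ L ⊆ 𝓢.lateTimeOmegaLimitSet B lim' Ψ τ₀ L :=
  seqOmegaLimit_mono fun s l ↦ h _ s l

/-- The late-time ω-limit set only depends on the tail: starting the translates at `T₀` instead
of `0` gives the same set (Hale 1980, Ch. I, §8, Thm. 8.1). [cite: Hale1980, Ch. I §8 Thm. 8.1] -/
theorem seqOmegaLimit_translatedChartMetric_add (T₀ : ℝ) :
    seqOmegaLimit (lim (Subtype.val '' B.timeSlabIoo τ₀ L))
        (fun T ↦ 𝓢.translatedChartMetric B Ψ (T + T₀)) =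
      𝓢.lateTimeOmegaLimitSet B lim Ψ τ₀ L :=
  seqOmegaLimit_comp_add_right _ _ T₀

end

/-- The **late-time Burnett ω-limit set** `ω_B(𝓢, Ψ, S_L)`: `lateTimeOmegaLimitSet` for Burnett
convergence on the slab — the set of component maps `g_∞` such that, along some `T_n → +∞`,
`g_{T_n} → g_∞` locally uniformly on `S_L = {τ₀ < t < τ₀ + L}` with equi-Lipschitz bounds
(`BurnettConverges`, `BurnettConvergence.lean`: Burnett 1989; Huneau–Luk arXiv:2403.03470,
Remark 1.3, the Lipschitz / no-frequency-scale form). Pairs `(g_∞, μ_∞)` with a defect measure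
are the instance `lateTimeOmegaLimitSet … (fun S s l ↦ BurnettConverges S s l.1 ∧ …)` once the
defect-measure datum is available. No existence is claimed (that is late-time Burnett
compactness). [cite: HuneauLuk2024wave, Remark 1.3] -/
def lateTimeBurnettOmegaLimitSet (Ψ : B.domain → 𝓢.carrier) (τ₀ L : ℝ) :
    Set (E4 → E4 →L[ℝ] E4 →L[ℝ] ℝ) :=
  𝓢.lateTimeOmegaLimitSet B BurnettConverges Ψ τ₀ L

/-- Membership in the late-time Burnett ω-limit set. [cite: HuneauLuk2024wave, Remark 1.3] -/
theorem mem_lateTimeBurnettOmegaLimitSet_iff {Ψ : B.domain → 𝓢.carrier} {τ₀ L : ℝ}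
    {g : E4 → E4 →L[ℝ] E4 →L[ℝ] ℝ} :
    g ∈ 𝓢.lateTimeBurnettOmegaLimitSet B Ψ τ₀ L ↔ ∃ T : ℕ → ℝ, Tendsto T atTop atTop ∧
      BurnettConverges (Subtype.val '' B.timeSlabIoo τ₀ L)
        (fun n ↦ 𝓢.translatedChartMetric B Ψ (T n)) g :=
  Iff.rfl

variable {𝓢 B} in
/-- **Burnett ω-limits are locally Lipschitz** on the slab (a Burnett limit is locally Lipschitz,
`BurnettConverges.locallyLipschitzOn_limit`; Huneau–Luk arXiv:1907.10743, §1: the limit metric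
is only Lipschitz — the thin-shell regime). [cite: HuneauLuk2024trilinear, §1] -/
theorem locallyLipschitzOn_of_mem_lateTimeBurnettOmegaLimitSet {Ψ : B.domain → 𝓢.carrier}
    {τ₀ L : ℝ} {g : E4 → E4 →L[ℝ] E4 →L[ℝ] ℝ} (h : g ∈ 𝓢.lateTimeBurnettOmegaLimitSet B Ψ τ₀ L) :
    LocallyLipschitzOn (Subtype.val '' B.timeSlabIoo τ₀ L) g := by
  obtain ⟨T, -, hT⟩ := h
  exact hT.locallyLipschitzOn_limit

variable {𝓢 B} in
/-- Burnett ω-limits are continuous on the slab (`BurnettConverges.continuousOn_limit`).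
[cite: HuneauLuk2024wave, Remark 1.3] -/
theorem continuousOn_of_mem_lateTimeBurnettOmegaLimitSet {Ψ : B.domain → 𝓢.carrier}
    {τ₀ L : ℝ} {g : E4 → E4 →L[ℝ] E4 →L[ℝ] ℝ} (h : g ∈ 𝓢.lateTimeBurnettOmegaLimitSet B Ψ τ₀ L) :
    ContinuousOn g (Subtype.val '' B.timeSlabIoo τ₀ L) := by
  obtain ⟨T, -, hT⟩ := h
  exact hT.continuousOn_limit

/-- The Burnett ω-limit set only depends on the tail of the translates (Hale 1980, Ch. I, §8,
Thm. 8.1). [cite: Hale1980, Ch. I §8 Thm. 8.1] -/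
theorem seqOmegaLimit_burnett_translatedChartMetric_add (Ψ : B.domain → 𝓢.carrier) (τ₀ L T₀ : ℝ) :
    seqOmegaLimit (BurnettConverges (Subtype.val '' B.timeSlabIoo τ₀ L))
        (fun T ↦ 𝓢.translatedChartMetric B Ψ (T + T₀)) =
      𝓢.lateTimeBurnettOmegaLimitSet B Ψ τ₀ L :=
  seqOmegaLimit_comp_add_right _ _ T₀

/-- **Uniform Burnett bounds** for the chart `Ψ` on the slabs of length `L` after `τ₀`: there is
`C` such that for every `T ≥ 0` the `C⁰` and `C¹` sup norms of the translate `g_T` over the slab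
`S_L = {τ₀ < t < τ₀ + L}` are at most `C` — i.e. (stationary background,
`hasUniformBurnettBounds_iff_forall_slab`) on every slab `{τ₀ + T < t < τ₀ + T + L}` the
pulled-back components are bounded with bounded first derivatives, uniformly in the start time.
This is the a-priori hypothesis of Burnett's compactness setting, `sup_n (|g_n| + |∂g_n|) < ∞`
(Burnett 1989; Huneau–Luk arXiv:2403.03470, Assumptions 1.2 (2)–(3) with Remark 1.3: no
frequency scale `λ_n`, no second-derivative bound), for the family of translates: for the
smooth `g_T` of a smooth late chart the `C¹` bound is the equi-Lipschitz bound of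
`BurnettConverges` on convex pieces of the slab (mean value inequality, as in
`BurnettConvergesAtScale.burnettConverges`). The wave-coordinate defect control (1.3)–(1.4) is
not included. An assumption, not a conclusion. [cite: HuneauLuk2024wave, Assumptions 1.2 and Remark 1.3] -/
def HasUniformBurnettBounds (Ψ : B.domain → 𝓢.carrier) (τ₀ L : ℝ) : Prop :=
  ∃ C : ℝ≥0, ∀ T : ℝ, 0 ≤ T →
    supCkENorm (Subtype.val '' B.timeSlabIoo τ₀ L) 1 (𝓢.translatedChartMetric B Ψ T) ≤ C

variable {𝓢 B}

/-- Uniform Burnett bounds persist on shorter slabs. [cite: HuneauLuk2024wave, Assumptions 1.2] -/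
theorem HasUniformBurnettBounds.mono {Ψ : B.domain → 𝓢.carrier} {τ₀ L L' : ℝ}
    (h : 𝓢.HasUniformBurnettBounds B Ψ τ₀ L') (hL : L ≤ L') :
    𝓢.HasUniformBurnettBounds B Ψ τ₀ L := by
  obtain ⟨C, hC⟩ := h
  exact ⟨C, fun T hT ↦ (supCkENorm_mono (image_mono (B.timeSlabIoo_mono τ₀ hL)) _ _).trans
    (hC T hT)⟩

/-- For a stationary background, uniform Burnett bounds say: one constant bounds the `C¹` sup
norm of `Ψ^* g` on every slab `{τ₀ + T < t < τ₀ + T + L}`, `T ≥ 0` (the form used by the route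
item LateTimeBurnettCompactness). [cite: HuneauLuk2024wave, Assumptions 1.2] -/
theorem hasUniformBurnettBounds_iff_forall_slab (hB : B.IsStationary) (Ψ : B.domain → 𝓢.carrier)
    (τ₀ L : ℝ) : 𝓢.HasUniformBurnettBounds B Ψ τ₀ L ↔ ∃ C : ℝ≥0, ∀ T : ℝ, 0 ≤ T →
      𝓢.chartMetricCk B Ψ 1 (B.timeSlabIoo (τ₀ + T) L) ≤ C := by
  simp only [HasUniformBurnettBounds, 𝓢.supCkENorm_translatedChartMetric_timeSlabIoo hB]

/-- For a stationary background and `L > 0`, uniform Burnett bounds on the slabs of length `L`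
are equivalent to finiteness of the `C¹` sup norm of `Ψ^* g` over the whole late region
`{t > τ₀}` (the slabs `{τ₀ + T < t < τ₀ + T + L}`, `T ≥ 0`, cover it). [cite: HuneauLuk2024wave, Assumptions 1.2] -/
theorem hasUniformBurnettBounds_iff_of_isStationary (hB : B.IsStationary)
    (Ψ : B.domain → 𝓢.carrier) (τ₀ : ℝ) {L : ℝ} (hL : 0 < L) :
    𝓢.HasUniformBurnettBounds B Ψ τ₀ L ↔ 𝓢.chartMetricCk B Ψ 1 (B.lateRegion τ₀) ≠ ⊤ := by
  rw [hasUniformBurnettBounds_iff_forall_slab hB]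
  constructor
  · rintro ⟨C, hC⟩
    refine ne_top_of_le_ne_top ENNReal.coe_ne_top (?_ : _ ≤ (C : ℝ≥0∞))
    refine iSup₂_le fun m hm ↦ iSup₂_le fun y hy ↦ ?_
    obtain ⟨x, hx, rfl⟩ := hy
    rw [← B.iUnion_timeSlabIoo_eq_lateRegion hL τ₀] at hx
    obtain ⟨T, hT, hxT⟩ := mem_iUnion₂.1 hx
    exact (enorm_iteratedFDeriv_le_supCkENorm hm (mem_image_of_mem _ hxT) _).trans (hC T hT)
  · intro h
    refine ⟨(𝓢.chartMetricCk B Ψ 1 (B.lateRegion τ₀)).toNNReal, fun T hT ↦ ?_⟩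
    rw [ENNReal.coe_toNNReal h]
    exact 𝓢.chartMetricCk_mono B Ψ 1 (B.timeSlabIoo_subset_lateRegion_of_le (by linarith) L)

/-! ### Burnett ω-limits together with their defect measures -/

/-- The **late-time Burnett ω-limit set with defect measures**: the pairs `(g_∞, μ_∞)` of a
component map and a measure on the cosphere bundle `E4 × S(E4)` such that, along some
`T_n → +∞`, `g_{T_n} → g_∞` in Burnett's sense on the slab `S_L` (`BurnettConverges`) AND `μ_∞`
is a defect-measure datum of that same sequence (`IsBurnettDefectDatum`,
`BurnettDefectMeasure.lean`: the consequence form of Huneau–Luk arXiv:2403.03470, Def. 4.1 with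
(1.5)) — the instance `Λ = metric × measure` of `lateTimeOmegaLimitSet`. Its first projection
lies in `lateTimeBurnettOmegaLimitSet` (`fst_image_lateTimeBurnettDefectOmegaLimitSet_subset`).
No existence is claimed (extraction of defect measures is Gérard's theorem, not vendored here).
[cite: HuneauLuk2024wave, Definition 4.1] -/
def lateTimeBurnettDefectOmegaLimitSet (𝓢 : Spacetime.{u} 4) (B : ModelBackground)
    (Ψ : B.domain → 𝓢.carrier) (τ₀ L : ℝ) :
    Set ((E4 → E4 →L[ℝ] E4 →L[ℝ] ℝ) × MeasureTheory.Measure (E4 × Metric.sphere (0 : E4) 1)) :=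
  𝓢.lateTimeOmegaLimitSet B
    (fun S s l ↦ BurnettConverges S s l.1 ∧ IsBurnettDefectDatum S s l.1 l.2) Ψ τ₀ L

/-- Membership: `(g, μ)` is a late-time Burnett ω-limit with defect measure iff along some
`T_n → ∞` the translates Burnett-converge to `g` on `S_L` and `μ` is a defect datum of them.
[cite: HuneauLuk2024wave, Definition 4.1] -/
theorem mem_lateTimeBurnettDefectOmegaLimitSet_iff {Ψ : B.domain → 𝓢.carrier} {τ₀ L : ℝ}
    {l : (E4 → E4 →L[ℝ] E4 →L[ℝ] ℝ) × MeasureTheory.Measure (E4 × Metric.sphere (0 : E4) 1)} :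
    l ∈ 𝓢.lateTimeBurnettDefectOmegaLimitSet B Ψ τ₀ L ↔ ∃ T : ℕ → ℝ, Tendsto T atTop atTop ∧
      BurnettConverges (Subtype.val '' B.timeSlabIoo τ₀ L)
        (fun n ↦ 𝓢.translatedChartMetric B Ψ (T n)) l.1 ∧
      IsBurnettDefectDatum (Subtype.val '' B.timeSlabIoo τ₀ L)
        (fun n ↦ 𝓢.translatedChartMetric B Ψ (T n)) l.1 l.2 :=
  Iff.rfl

/-- Forgetting the defect measure maps the ω-limit set with defect measures into the Burnett
ω-limit set. [cite: HuneauLuk2024wave, Definition 4.1] -/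
theorem fst_image_lateTimeBurnettDefectOmegaLimitSet_subset (Ψ : B.domain → 𝓢.carrier)
    (τ₀ L : ℝ) : Prod.fst '' 𝓢.lateTimeBurnettDefectOmegaLimitSet B Ψ τ₀ L ⊆
      𝓢.lateTimeBurnettOmegaLimitSet B Ψ τ₀ L := by
  rintro _ ⟨l, ⟨T, hT, hl, -⟩, rfl⟩
  exact ⟨T, hT, hl⟩

end Spacetime

end Literature.Geometry.Lorentzian

end
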